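import Summits.MatrixMultiplication.MatrixMultiplication.Theses.DefinableSTPPDichotomy
import Summits.MatrixMultiplication.MatrixMultiplication.Theorems.PairwiseCurvedTilingsLC.Negative.LonelyTranslates
import Summits.MatrixMultiplication.MatrixMultiplication.Theorems.PairwiseCurvedTilingsLC.Negative.ShadowFormulaRealize
import Summits.MatrixMultiplication.MatrixMultiplication.Theorems.PairwiseCurvedTilingsLC.Negative.ShadowCounting
import Summits.MatrixMultiplication.MatrixMultiplication.Theorems.PairwiseCurvedTilingsLC.Negative.LonelyShadowFormula
import Summits.MatrixMultiplication.MatrixMultiplication.Theorems.PairwiseCurvedTilingsLC.Negative.PairwiseCurvedTilingsLCFalseOfEtaleOpenFacts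
import Summits.MatrixMultiplication.MatrixMultiplication.Theorems.PairwiseCurvedTilingsLC.Negative.CharZeroUniformBound
import Summits.MatrixMultiplication.MatrixMultiplication.Theorems.PairwiseCurvedTilingsLC.Negative.GenericInterior
import Summits.MatrixMultiplication.MatrixMultiplication.Theorems.PairwiseCurvedTilingsLC.Negative.ChartInduction
import Literature.ModelTheory.PseudofiniteFields.AlgebraicBoundedness
import Literature.ModelTheory.PseudofiniteFields.EtaleOpenTopologyProofs
import Literature.ModelTheory.PseudofiniteFields.EtaleOpenTopologyBasis
import Literature.ModelTheory.PseudofiniteFields.GenericEtaleInterior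
import Literature.ModelTheory.PseudofiniteFields.DefinableSetsFiniteFieldsDecomposition
import Literature.ModelTheory.PseudofiniteFields.DefinableExponentialSums
import Literature.ModelTheory.PseudofiniteFields.FiniteFieldTheory
import Literature.ModelTheory.PseudofiniteFields.CharZeroTransfer

/-!
# `PairwiseCurvedTilingsLC` (crux stmt-MatrixMultiplication-17883) is FALSE — conditionally on the
# two printed inputs of the CDM Main Theorem only (line LonelyTranslates, continuation c1)

`not_PairwiseCurvedTilingsLC_of_prop27_of_prop33 :
  ChatzidakisVanDenDriesMacintyre1992_prop27 → ChatzidakisVanDenDriesMacintyre1992_prop33 → ¬ PairwiseCurvedTilingsLC`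
(Chatzidakis–van den Dries–Macintyre 1992, Prop. (2.7): the positive one-variable normal form of
definable sets in enriched pseudo-finite fields; Prop. (3.3): Lang–Weil for affine algebraic sets).
Compared with the line's first composition `not_PairwiseCurvedTilingsLC_of_facts` (p150554:
JTWY 7.1 psf, Walsberg–Ye Thm C psf, CDM Main Theorem), Johnson–Tran–Walsberg–Ye Thm 7.1 is now a
THEOREM of the tree (`JohnsonTranWalsbergYe2024_thm71_psf_holds`) and Walsberg–Ye is NO LONGER
USED: its two consequences consumed by the lonely-translate argument are proved in the tree for
pseudo-finite fields of CHARACTERISTIC ZERO — enough, since the crux lets `char F → ∞` —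

* (a) generic points of a definable set are étale-interior (`stub_genericInterior`,
  GenericInterior.lean), and
* (b) an infinite definable set contains a nonempty étale-open subset of a standard smooth locus
  of codimension `< m` (`stub_openPiece`, ChartInduction.lean),

both from the CDM Prop. (2.7) normal form (`exists_polynomial_normalForm`) through the purely
algebraic generic-simple-roots theorem (`stub_relGen`, characteristic `0`: radicals are separable)
and a chart induction (`exists_goodChart`).  Prop. (3.3) enters only through the algebraic
boundedness of pseudo-finite fields (`…mainTheorem.infinite_of_injective`).

## The proof

1. (`porosityShadowBound_of_prop27`) `PorosityShadowBound`: in a characteristic-`0` pseudo-finite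
   field `K`, the `A − C` shadow `U` is definable (`shadowFormula`) hence étale-open off a
   hypersurface `D = 0` by (a); an infinite block `B_x` has a non-étale-isolated point by (b) and
   JTWY 7.1; pattern `i = j` of the pairwise clause then puts every shadow point over an infinite
   block on `D = 0` (`noLonely_of_interior_of_nonisolated`: translate a neighbourhood `E ⊆ U` of
   the shadow point to the non-isolated point of the block and read off a second block point whose
   translate lands in `U`, against the lonely-translate pattern); blocks with `> C` points are
   infinite (algebraic boundedness); the conclusion is one ring formula `θ_{C,N}(y)`
   (`stub_exists_lonelyShadowFormula`); compactness over characteristic-`0` pseudo-finite fields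
   (`stub_charZeroUniformBound`) makes `N` uniform and the transfer ALONG THE CHARACTERISTIC
   (`FiniteField.eventually_realize_forall_of_pseudoFinite_charZero`) moves `⋁_{n ≤ N} θ_{C,n}` to
   all finite fields of large characteristic; Schwartz–Zippel (`stub_shadow_card_le`) finishes.
2. `notLC_of_shadowBound : PorosityShadowBound → ¬ PairwiseCurvedTilingsLC` (landed, p149420).

References: ChatzidakisVanDenDriesMacintyre1992 ((2.7), (3.3)); JohnsonTranWalsbergYe2024
(Thm 7.1); Ax1968; crux dir `Cruxes/PairwiseCurvedTilingsLC/` (PICKED.md, Lines/LonelyTranslates.lean).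
-/

set_option linter.dupNamespace false

namespace Summit.MatrixMultiplication.MatrixMultiplication.Theorems.PairwiseCurvedTilingsLC.Negative

open Finset
open FirstOrder FirstOrder.Language FirstOrder.Ring
open Literature.ModelTheory.PseudofiniteFields
open Summit.MatrixMultiplication.MatrixMultiplication.Theses.DefinableSTPPDichotomy

/-! ## The lonely-translate step from (a) and (b) -/

section NoLonely

variable {K : Type} [Field K] {e m : ℕ}

/-- **No interior shadow point over an infinite block.**  If the `A − C` shadow `U` is étale-open
off `D = 0` (hypothesis `hU`, from (a)), every infinite block `B_x` has a point that is not
étale-isolated in `B_x` (hypothesis `hB`, from (b) and JTWY 7.1), and the family satisfies pattern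
`i = j` of the pairwise STPP clause, then every shadow point over an infinite block lies on `D = 0`:
an interior shadow point `w = a − u` would have a neighbourhood `E ⊆ U`; translating it to a
non-isolated `t₀ ∈ B_x` yields `t ≠ t₀` in `B_x` with `w + t − t₀ ∈ U`, against the pattern. -/
theorem noLonely_of_interior_of_nonisolated
    (I : Set (Fin e → K)) (A B C : (Fin e → K) → Set (Fin m → K))
    (hpat : ∀ i ∈ I, ∀ k ∈ I, ∀ s ∈ A k, ∀ s' ∈ A i, ∀ t ∈ B i, ∀ t' ∈ B i, ∀ u ∈ C i,
      ∀ u' ∈ C k, (s' - s) + (t' - t) + (u' - u) = 0 → i = k ∧ s = s' ∧ t = t' ∧ u = u')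
    {D : MvPolynomial (Fin m) K}
    (hU : ∀ w ∈ {w | ∃ x ∈ I, ∃ a ∈ A x, ∃ u ∈ C x, w = a - u}, MvPolynomial.eval w D ≠ 0 →
      ∃ (r : ℕ) (E : EtaleDatum K m r), w ∈ E.image ∧
        E.image ⊆ {w | ∃ x ∈ I, ∃ a ∈ A x, ∃ u ∈ C x, w = a - u})
    (hB : ∀ x ∈ I, (B x).Infinite → ∃ t₀ ∈ B x, ∀ (r : ℕ) (E : EtaleDatum K m r),
      t₀ ∈ E.image → ∃ t ∈ B x, t ≠ t₀ ∧ t ∈ E.image) :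
    ∀ x ∈ I, (B x).Infinite → ∀ a ∈ A x, ∀ u ∈ C x, MvPolynomial.eval (a - u) D = 0 := by
  intro x hx hinf a ha u hu
  by_contra hD
  obtain ⟨r, E, hwE, hEU⟩ := hU (a - u) ⟨x, hx, a, ha, u, hu, rfl⟩ hD
  obtain ⟨t₀, ht₀, hni⟩ := hB x hx hinf
  obtain ⟨E', hE'⟩ := E.exists_image_eq_translate (a - u - t₀)
  have ht₀E' : t₀ ∈ E'.image := by
    rw [hE', Set.mem_setOf_eq]
    have : t₀ + (a - u - t₀) = a - u := by abel
    rw [this]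
    exact hwE
  obtain ⟨t, ht, htne, htE'⟩ := hni r E' ht₀E'
  rw [hE', Set.mem_setOf_eq] at htE'
  obtain ⟨x', hx', a', ha', u', hu', heq⟩ := hEU htE'
  have h0 : (a - a') + (t - t₀) + (u' - u) = 0 := by
    have : t + (a - u - t₀) = (a - a') + (t - t₀) + (u' - u) + (a' - u') := by abel
    rw [this] at heq
    exact add_eq_right.1 heq
  obtain ⟨-, -, ht0, -⟩ := hpat x hx x' hx' a' ha' a ha t₀ ht₀ t ht u hu u' hu' h0
  exact htne ht0.symm

end NoLonely

/-! ## The composition -/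

section Assembly

variable {e m k : ℕ}

/-- **`PorosityShadowBound` from CDM Prop. (2.7) and Prop. (3.3)** (the latter only through the
algebraic boundedness of pseudo-finite fields). -/
theorem porosityShadowBound_of_prop27 (h27 : ChatzidakisVanDenDriesMacintyre1992_prop27)
    (h33 : ChatzidakisVanDenDriesMacintyre1992_prop33) : PorosityShadowBound := by
  intro e m k φI φA φB φC
  classical
  have hCDM := ChatzidakisVanDenDriesMacintyre1992_mainTheorem_holds_of h33 h27
  -- (1) algebraic boundedness constant for the blocks `B_x`
  obtain ⟨C, hC⟩ := hCDM.infinite_of_injective m (e + k) (blockFormula φB)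
  -- (2) the encoding formulas
  choose θ hθ using fun N => stub_exists_lonelyShadowFormula e m k φI φA φB φC C N
  -- (3) in every CHARACTERISTIC-ZERO pseudo-finite field, every `y` satisfies some `θ_N`
  have hpw : ∀ (K : Type) [Field K] [CompatibleRing K] [CharZero K], K ⊨ finiteFieldTheory →
      ∀ y : Fin k → K, ∃ N, (θ N).Realize y := by
    intro K _ _ _ hK y
    haveI : Infinite K := Infinite.of_injective (Nat.cast : ℕ → K) Nat.cast_injective
    -- realised family (as sets)
    set I : Set (Fin e → K) := {x | φI.Realize (Sum.elim x y)} with hIdef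
    set A : (Fin e → K) → Set (Fin m → K) := fun x => {v | φA.Realize (Sum.elim (Sum.elim x v) y)}
      with hAdef
    set B : (Fin e → K) → Set (Fin m → K) := fun x => {v | φB.Realize (Sum.elim (Sum.elim x v) y)}
      with hBdef
    set C' : (Fin e → K) → Set (Fin m → K) := fun x => {v | φC.Realize (Sum.elim (Sum.elim x v) y)}
      with hCdef
    by_cases hpat : ∀ i ∈ I, ∀ k' ∈ I, ∀ s ∈ A k', ∀ s' ∈ A i, ∀ t ∈ B i, ∀ t' ∈ B i,
        ∀ u ∈ C' i, ∀ u' ∈ C' k', (s' - s) + (t' - t) + (u' - u) = 0 →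
          i = k' ∧ s = s' ∧ t = t' ∧ u = u'
    swap
    · -- pattern fails: `θ_0` holds vacuously
      refine ⟨0, (hθ 0 K y).2 fun hp => absurd ?_ hpat⟩
      intro i hi k' hk' s hs s' hs' t ht t' ht' u hu u' hu' h0
      exact hp i hi k' hk' s hs s' hs' t ht t' ht' u hu u' hu' h0
    -- (a) the shadow is étale-open off a hypersurface `D = 0`
    obtain ⟨D, hD0, hDint⟩ := stub_genericInterior h27 K hK (shadowFormula φI φA φC) y
    have hU : ∀ w ∈ {w | ∃ x ∈ I, ∃ a ∈ A x, ∃ u ∈ C' x, w = a - u}, MvPolynomial.eval w D ≠ 0 →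
        ∃ (r : ℕ) (E : EtaleDatum K m r), w ∈ E.image ∧
          E.image ⊆ {w | ∃ x ∈ I, ∃ a ∈ A x, ∃ u ∈ C' x, w = a - u} := by
      have hset : {x : Fin m → K | (shadowFormula φI φA φC).Realize (Sum.elim x y)} =
          {w | ∃ x ∈ I, ∃ a ∈ A x, ∃ u ∈ C' x, w = a - u} := by
        ext w
        simp only [Set.mem_setOf_eq, stub_realize_shadowFormula_iff]
        constructor
        · rintro ⟨x, hx, a, ha, u, hu, rfl⟩
          exact ⟨x, hx, a, ha, u, hu, rfl⟩
        · rintro ⟨x, hx, a, ha, u, hu, rfl⟩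
          exact ⟨x, hx, a, ha, u, hu, rfl⟩
      intro w hw hwD
      have hw' : (shadowFormula φI φA φC).Realize (Sum.elim w y) := by
        have : w ∈ {x : Fin m → K | (shadowFormula φI φA φC).Realize (Sum.elim x y)} := by
          rw [hset]; exact hw
        exact this
      obtain ⟨r, E, hwE, hEU⟩ := hDint w hw' hwD
      exact ⟨r, E, hwE, hset ▸ hEU⟩
    -- (b) every infinite block has a non-isolated point
    have hB : ∀ x ∈ I, (B x).Infinite → ∃ t₀ ∈ B x, ∀ (r : ℕ) (E : EtaleDatum K m r),
        t₀ ∈ E.image → ∃ t ∈ B x, t ≠ t₀ ∧ t ∈ E.image := by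
      intro x _ hBinf
      have hBx : B x = {v | (blockFormula φB).Realize (Sum.elim v (Fin.append x y))} := by
        ext v
        simp only [Set.mem_setOf_eq, realize_blockFormula_iff, hBdef]
      have hinf' : {v : Fin m → K | (blockFormula φB).Realize (Sum.elim v (Fin.append x y))}.Infinite :=
        hBx ▸ hBinf
      obtain ⟨c, S, X, hcm, hXB, ⟨t₀, ht₀⟩, hXopen⟩ :=
        stub_openPiece h27 K hK (blockFormula φB) (Fin.append x y) hinf'
      refine ⟨t₀, hBx ▸ hXB ht₀, fun r E ht₀E => ?_⟩
      obtain ⟨t, htX, htne, htE⟩ := exists_ne_mem_of_not_isEtaleIsolatedIn S hXopen ht₀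
        (JohnsonTranWalsbergYe2024_thm71_psf_holds K hK m c hcm S t₀) E ht₀E
      exact ⟨t, hBx ▸ hXB htX, htne, htE⟩
    have hDvan := noLonely_of_interior_of_nonisolated I A B C' hpat hU hB
    obtain ⟨d, hd0, hdev⟩ := exists_box_of_ne_zero D hD0 le_rfl
    refine ⟨D.totalDegree, (hθ _ K y).2 fun _ => ⟨d, hd0, ?_⟩⟩
    intro x hx hw a ha u hu
    obtain ⟨w, hwinj, hw⟩ := hw
    have hinf : (B x).Infinite := by
      have := hC K hK (Fin.append x y) w hwinj
        (fun j => (realize_blockFormula_iff φB x y (w j)).2 (hw j))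
      simpa [hBdef, realize_blockFormula_iff] using this
    rw [hdev]
    exact hDvan x hx hinf a ha u hu
  -- (4) a uniform index over characteristic-zero pseudo-finite fields
  obtain ⟨N, hN⟩ := stub_charZeroUniformBound θ hpw
  -- (5) transfer `⋁_{n ≤ N} θ_n` to all finite fields of large characteristic
  set ψ : Language.ring.Formula (Fin k) := BoundedFormula.iSup (fun n : Fin (N + 1) => θ n) with hψ
  have hψK : ∀ (K : Type) [Field K] [CompatibleRing K] [CharZero K], K ⊨ finiteFieldTheory →
      ∀ y : Fin k → K, ψ.Realize y := by
    intro K _ _ _ hK y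
    obtain ⟨n, hn, hreal⟩ := hN K hK y
    rw [hψ, Formula.Realize, BoundedFormula.realize_iSup]
    exact ⟨⟨n, Nat.lt_succ_of_le hn⟩, hreal⟩
  obtain ⟨q₀, hq₀⟩ := FiniteField.eventually_realize_forall_of_pseudoFinite_charZero ψ hψK
  -- (6) the finite-field statement
  refine ⟨max C (m * N), q₀, ?_⟩
  intro F _ _ instCR hchar y I A B C' hI hA hB hC hpat
  have hψF : ψ.Realize y := by
    rw [realize_iff_of_compatibleRing]
    exact hq₀ F hchar y
  rw [hψ, Formula.Realize, BoundedFormula.realize_iSup] at hψF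
  obtain ⟨n, hn⟩ := hψF
  have hsem : LonelyShadowSem e m k φI φA φB φC C n F y := (hθ n F y).1 hn
  have hpat' : ∀ i, φI.Realize (Sum.elim i y) → ∀ i', φI.Realize (Sum.elim i' y) →
      ∀ s, φA.Realize (Sum.elim (Sum.elim i' s) y) → ∀ s', φA.Realize (Sum.elim (Sum.elim i s') y) →
      ∀ t, φB.Realize (Sum.elim (Sum.elim i t) y) → ∀ t', φB.Realize (Sum.elim (Sum.elim i t') y) →
      ∀ u, φC.Realize (Sum.elim (Sum.elim i u) y) →
      ∀ u', φC.Realize (Sum.elim (Sum.elim i' u') y) →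
        (s' - s) + (t' - t) + (u' - u) = 0 → i = i' ∧ s = s' ∧ t = t' ∧ u = u' := by
    intro i hi i' hi' s hs s' hs' t ht t' ht' u hu u' hu' h0
    exact hpat i ((hI i).2 hi) i' ((hI i').2 hi') s ((hA i' s).2 hs) s' ((hA i s').2 hs')
      t ((hB i t).2 ht) t' ((hB i t').2 ht') u ((hC i u).2 hu) u' ((hC i' u').2 hu') h0
  obtain ⟨d, hd0, hdvan⟩ := hsem hpat'
  set Cb : ℕ := max C (m * N) with hCb
  set I₁ := I.filter (fun x => Cb < (B x).card) with hI₁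
  have hI₁I : I₁ ⊆ I := filter_subset _ _
  have hpat₁ : ∀ i ∈ I₁, ∀ k' ∈ I₁, ∀ s ∈ A k', ∀ s' ∈ A i, ∀ t ∈ B i, ∀ t' ∈ B i, ∀ u ∈ C' i,
      ∀ u' ∈ C' k', (s' - s) + (t' - t) + (u' - u) = 0 → i = k' ∧ s = s' ∧ t = t' ∧ u = u' :=
    fun i hi k' hk' => hpat i (hI₁I hi) k' (hI₁I hk')
  have hB₁ : ∀ x ∈ I₁, (B x).Nonempty := fun x hx =>
    card_pos.1 (lt_of_le_of_lt (Nat.zero_le _) (mem_filter.1 hx).2)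
  have hvan : ∀ x ∈ I₁, ∀ a ∈ A x, ∀ u ∈ C' x,
      ∑ β : Fin m → Fin (n + 1), d β * ∏ l : Fin m, (a - u) l ^ ((β l : ℕ)) = 0 := by
    intro x hx a ha u hu
    obtain ⟨hxI, hxB⟩ := mem_filter.1 hx
    have hCB : C < (B x).card := lt_of_le_of_lt (le_max_left _ _) hxB
    obtain ⟨w, hw⟩ : ∃ w : Fin (C + 1) ↪ (Fin m → F), ∀ j, w j ∈ B x := by
      have h : C + 1 ≤ (B x).card := hCB
      obtain ⟨s, hs, hscard⟩ := Finset.exists_subset_card_eq h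
      refine ⟨(Finset.equivFinOfCardEq hscard).symm.toEmbedding.trans
        (Function.Embedding.subtype _), fun j => hs ?_⟩
      exact Finset.coe_mem _
    exact hdvan x ((hI x).1 hxI) ⟨w, w.injective, fun j => (hB x (w j)).1 (hw j)⟩
      a ((hA x a).1 ha) u ((hC x u).1 hu)
  have hle := stub_shadow_card_le I₁ A B C' hpat₁ hB₁ d hd0 hvan
  have hq0 : (0 : ℝ) ≤ (Fintype.card F : ℝ) ^ ((m : ℝ) - 1) := by positivity
  calc ((∑ x ∈ I.filter (fun x => Cb < (B x).card), (A x).card * (C' x).card : ℕ) : ℝ)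
      ≤ ((m * n : ℕ) : ℝ) * (Fintype.card F : ℝ) ^ ((m : ℝ) - 1) := hle
    _ ≤ (Cb : ℝ) * (Fintype.card F : ℝ) ^ ((m : ℝ) - 1) := by
        apply mul_le_mul_of_nonneg_right _ hq0
        have h1 : m * n ≤ m * N := Nat.mul_le_mul_left m (Nat.lt_succ_iff.1 n.2)
        have h2 : m * N ≤ Cb := le_max_right _ _
        exact_mod_cast h1.trans h2

/-- **The crux is FALSE conditionally on CDM Prop. (2.7) and Prop. (3.3)** (the two printed
inputs of the Chatzidakis–van den Dries–Macintyre Main Theorem; Walsberg–Ye is no longer used, and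
JTWY 7.1 is a theorem of the tree). -/
theorem not_PairwiseCurvedTilingsLC_of_prop27_of_prop33
    (h27 : ChatzidakisVanDenDriesMacintyre1992_prop27)
    (h33 : ChatzidakisVanDenDriesMacintyre1992_prop33) : ¬ PairwiseCurvedTilingsLC :=
  notLC_of_shadowBound (porosityShadowBound_of_prop27 h27 h33)

end Assembly

end Summit.MatrixMultiplication.MatrixMultiplication.Theorems.PairwiseCurvedTilingsLC.Negative
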